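import Literature.Probability.Process.ItoIntegralCovariationSimple
import Literature.Probability.Process.ProgressiveDensity
import HarnessLib

/-!
# Covariation of elementary stochastic integrals against two integrators, II: arbitrary simple
# integrands, and `L²` tools

Second file of three (see `ItoIntegralCovariationSimple` for the setting: raw filtration `𝓕`,
square-integrable martingales `B, B'` with `B B' - c t` a martingale).

* `SimpleProcess.setIntegral_toProcess_mul_eq_sum` — the time integral of a product of two step
  processes on a common grid between grid points, `∫_{(t_p,t_q]} H(r⁺) K(r⁺) dr =
  ∑_{p≤i<q} Hᵢ Kᵢ (tᵢ₊₁ - tᵢ)`;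
* `SimpleProcess.integral_mul_sub_mul_sub` — **conditional covariation of two elementary
  integrals with arbitrary partitions**: for `s ≤ t` and bounded `𝓕_s`-measurable `Z`,
  `E[Z ((H·B)_t - (H·B)_s)((K·B')_t - (K·B')_s)] = c E[Z ∫_{(s,t]} H(r⁺) K(r⁺) dr]`
  (refine both partitions to a common one through `s, t` — `SimpleProcess.refine` does not change
  step processes or elementary integrals — and apply part I);
* `L²` tools for the passage to the limit (part III): Cauchy–Schwarz in `ℝ≥0∞` form
  (`lintegral_enorm_mul_le_sqrt_mul_sqrt`), products of `L²`-convergent sequences converge in `L¹`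
  (`tendsto_lintegral_enorm_mul_sub_mul`), and with a bounded weight
  (`tendsto_integral_mul_mul_of_lintegral_sq`).

## References

* D. Revuz, M. Yor, *Continuous Martingales and Brownian Motion* (3rd ed., 1999), Ch. IV,
  Def. (2.1), §2 after Def. (2.3) (refinement of subdivisions), Thm (2.2).
-/

open MeasureTheory ProbabilityTheory Filter Finset
open scoped NNReal ENNReal Topology

noncomputable section

namespace Literature.Probability.Process

variable {Ω : Type*} {m : MeasurableSpace Ω} {𝓕 : Filtration ℝ≥0 m} {μ : Measure Ω}

namespace SimpleProcess

/-! ### The time integral of a product of step processes over grid cells -/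

section TimeIntegral

/-- On the real cell `(tᵢ, tᵢ₊₁]` the step process read at `r⁺` is the `i`-th value. [folklore] -/
private theorem toProcess_toNNReal_eq_value_of_mem_Ioc (H : SimpleProcess m 𝓕) {i : ℕ}
    (hi : i + 1 < H.times.length) {r : ℝ}
    (hr : r ∈ Set.Ioc (H.time i : ℝ) (H.time (i + 1))) (ω : Ω) :
    H.toProcess r.toNNReal ω = H.value i ω :=
  H.toProcess_eq_value_of_mem_Ioc hi
    ⟨Real.lt_toNNReal_iff_coe_lt.2 hr.1, Real.toNNReal_le_iff_le_coe.2 hr.2⟩ ω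

variable (H K : SimpleProcess m 𝓕) (hHK : K.times = H.times)
include hHK

/-- The product of two step processes on a common grid is integrable on every grid cell
(it is constant there). [folklore] -/
private theorem integrableOn_toProcess_mul_cell {i : ℕ} (hi : i + 1 < H.times.length) (ω : Ω) :
    IntegrableOn (fun r : ℝ ↦ H.toProcess r.toNNReal ω * K.toProcess r.toNNReal ω)
      (Set.Ioc (H.time i : ℝ) (H.time (i + 1))) volume := by
  have hKt : ∀ j, K.time j = H.time j := fun j ↦ by simp only [SimpleProcess.time, hHK]
  refine (integrableOn_const (s := Set.Ioc (H.time i : ℝ) (H.time (i + 1))) (μ := volume)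
    (C := H.value i ω * K.value i ω) (by simp) ).congr_fun (fun r hr ↦ ?_) measurableSet_Ioc
  rw [H.toProcess_toNNReal_eq_value_of_mem_Ioc hi hr ω]
  have hr' : r ∈ Set.Ioc (K.time i : ℝ) (K.time (i + 1)) := by rwa [hKt, hKt]
  rw [K.toProcess_toNNReal_eq_value_of_mem_Ioc (by rw [hHK]; exact hi) hr' ω]

/-- The product of two step processes on a common grid is integrable between grid points.
[folklore] -/
private theorem integrableOn_toProcess_mul {p q : ℕ} (hpq : p ≤ q) (hq : q < H.times.length) (ω : Ω) :
    IntegrableOn (fun r : ℝ ↦ H.toProcess r.toNNReal ω * K.toProcess r.toNNReal ω)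
      (Set.Ioc (H.time p : ℝ) (H.time q)) volume := by
  induction q, hpq using Nat.le_induction with
  | base => simp
  | succ q hpq ih =>
    have hq' : q < H.times.length := by omega
    rw [← Set.Ioc_union_Ioc_eq_Ioc (NNReal.coe_le_coe.2 (H.time_mono hpq hq'))
      (NNReal.coe_le_coe.2 (H.time_mono (Nat.le_succ q) hq))]
    exact (ih hq').union (H.integrableOn_toProcess_mul_cell K hHK hq ω)

/-- **Time integral of a product of step processes between grid points**:
`∫_{(t_p, t_q]} H(r⁺) K(r⁺) dr = ∑_{p ≤ i < q} Hᵢ Kᵢ (tᵢ₊₁ - tᵢ)` for two simple processes on a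
common grid.
[folklore] -/
private theorem setIntegral_toProcess_mul_eq_sum {p q : ℕ} (hpq : p ≤ q) (hq : q < H.times.length)
    (ω : Ω) :
    ∫ r in Set.Ioc (H.time p : ℝ) (H.time q), H.toProcess r.toNNReal ω * K.toProcess r.toNNReal ω =
      ∑ i ∈ Ico p q, H.value i ω * K.value i ω * ((H.time (i + 1) : ℝ) - H.time i) := by
  have hKt : ∀ j, K.time j = H.time j := fun j ↦ by simp only [SimpleProcess.time, hHK]
  induction q, hpq using Nat.le_induction with
  | base => simp
  | succ q hpq ih =>
    have hq' : q < H.times.length := by omega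
    have h1 : (H.time p : ℝ) ≤ H.time q := NNReal.coe_le_coe.2 (H.time_mono hpq hq')
    have h2 : (H.time q : ℝ) ≤ H.time (q + 1) := NNReal.coe_le_coe.2 (H.time_mono (Nat.le_succ q) hq)
    rw [← Set.Ioc_union_Ioc_eq_Ioc h1 h2, setIntegral_union (Set.Ioc_disjoint_Ioc_of_le le_rfl)
      measurableSet_Ioc (H.integrableOn_toProcess_mul K hHK hpq hq' ω)
      (H.integrableOn_toProcess_mul_cell K hHK hq ω), ih hq', sum_Ico_succ_top hpq]
    congr 1
    have hcell : ∫ r in Set.Ioc (H.time q : ℝ) (H.time (q + 1)),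
        H.toProcess r.toNNReal ω * K.toProcess r.toNNReal ω =
        ∫ r in Set.Ioc (H.time q : ℝ) (H.time (q + 1)), H.value q ω * K.value q ω := by
      refine setIntegral_congr_fun measurableSet_Ioc fun r hr ↦ ?_
      have hr' : r ∈ Set.Ioc (K.time q : ℝ) (K.time (q + 1)) := by rwa [hKt, hKt]
      rw [H.toProcess_toNNReal_eq_value_of_mem_Ioc hq hr ω,
        K.toProcess_toNNReal_eq_value_of_mem_Ioc (by rw [hHK]; exact hq) hr' ω]
    rw [hcell, setIntegral_const, smul_eq_mul, Real.volume_real_Ioc_of_le h2, mul_comm]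

end TimeIntegral

/-! ### Arbitrary simple integrands: refinement through `s` and `t` -/

section Refined

variable [IsFiniteMeasure μ] {B B' : ℝ≥0 → Ω → ℝ} {c : ℝ}

/-- **Conditional covariation of two elementary integrals**: for bounded simple `H, K`
(arbitrary partitions), square-integrable martingales `B, B'` with `B B' - c t` a martingale,
`s ≤ t` and a bounded `𝓕_s`-measurable weight `Z`,
`E[Z ((H·B)_t - (H·B)_s) ((K·B')_t - (K·B')_s)] = c E[Z ∫_{(s,t]} H(r⁺) K(r⁺) dr]`
(refine both partitions to a common one through `s` and `t`, then
`integral_mul_cellSum_mul_cellSum`).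
[cite: RevuzYor1999, Ch. IV Thm (2.2) (`(K·M)N - K·⟨M,N⟩` is a martingale, `K ∈ ℰ`; proof p. 138)] -/
theorem integral_mul_sub_mul_sub (H K : SimpleProcess m 𝓕)
    (hB : Martingale B 𝓕 μ) (hB' : Martingale B' 𝓕 μ)
    (hB2 : ∀ t, MemLp (B t) 2 μ) (hB'2 : ∀ t, MemLp (B' t) 2 μ)
    (hcov : Martingale (fun t ω ↦ B t ω * B' t ω - c * (t : ℝ)) 𝓕 μ)
    {s t : ℝ≥0} (hst : s ≤ t) {Z : Ω → ℝ} (hZ : StronglyMeasurable[𝓕 s] Z) {C : ℝ}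
    (hC : ∀ ω, |Z ω| ≤ C) :
    ∫ ω, Z ω * ((H.integral B t ω - H.integral B s ω) * (K.integral B' t ω - K.integral B' s ω)) ∂μ =
      c * ∫ ω, Z ω * (∫ r in Set.Ioc (s : ℝ) t,
        H.toProcess r.toNNReal ω * K.toProcess r.toNNReal ω) ∂μ := by
  -- the common refinement through `s` and `t`
  set u : List ℝ≥0 := ((H.times ++ K.times ++ [s, t]).toFinset).sort with hu_def
  have hu : u.SortedLT := Finset.sortedLT_sort _
  have hmem : ∀ x, x ∈ u ↔ x ∈ H.times ++ K.times ++ [s, t] := fun x ↦ by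
    rw [hu_def, Finset.mem_sort, List.mem_toFinset]
  have hHu : H.times ⊆ u := fun x hx ↦ (hmem x).2 (by simp [hx])
  have hKu : K.times ⊆ u := fun x hx ↦ (hmem x).2 (by simp [hx])
  set H' := H.refine u hu hHu with hH'
  set K' := K.refine u hu hKu with hK'
  have hlen : H'.times.length = u.length := rfl
  obtain ⟨p, hp, hps⟩ := H'.exists_time_eq_of_mem ((hmem s).2 (by simp) : s ∈ u)
  obtain ⟨q, hq, hqt⟩ := H'.exists_time_eq_of_mem ((hmem t).2 (by simp) : t ∈ u)
  have hpq : p ≤ q := (H'.time_le_time_iff hp hq).1 (by rw [hps, hqt]; exact hst)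
  -- transport to the refined processes
  have e1 : ∀ ω, H.integral B t ω - H.integral B s ω =
      ∑ i ∈ Ico p q, H'.value i ω * (B (H'.time (i + 1)) ω - B (H'.time i) ω) := fun ω ↦ by
    rw [← H.integral_refine u hu hHu B t ω, ← H.integral_refine u hu hHu B s ω, ← hps, ← hqt]
    exact H'.integral_time_sub_integral_time B hpq hq ω
  have e2 : ∀ ω, K.integral B' t ω - K.integral B' s ω =
      ∑ i ∈ Ico p q, K'.value i ω * (B' (H'.time (i + 1)) ω - B' (H'.time i) ω) := fun ω ↦ by
    rw [← K.integral_refine u hu hKu B' t ω, ← K.integral_refine u hu hKu B' s ω, ← hps, ← hqt]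
    exact K'.integral_time_sub_integral_time B' hpq hq ω
  have e3 : ∀ ω, ∫ r in Set.Ioc (s : ℝ) t, H.toProcess r.toNNReal ω * K.toProcess r.toNNReal ω =
      ∑ i ∈ Ico p q, H'.value i ω * K'.value i ω * ((H'.time (i + 1) : ℝ) - H'.time i) := by
    intro ω
    rw [← H'.setIntegral_toProcess_mul_eq_sum K' rfl hpq hq ω, hps, hqt]
    refine setIntegral_congr_fun measurableSet_Ioc fun r _ ↦ ?_
    rw [H.toProcess_refine u hu hHu, K.toProcess_refine u hu hKu]
  rw [hps.symm] at hZ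
  simp_rw [e1, e2, e3]
  exact H'.integral_mul_cellSum_mul_cellSum K' rfl hB hB' hB2 hB'2 hcov hpq hq hZ hC

end Refined

end SimpleProcess

/-! ### `L²` tools: Cauchy–Schwarz and continuity of products in `L¹` -/

section L2Tools

variable {α : Type*} {mα : MeasurableSpace α} {ν : Measure α}

/-- `‖f x‖ₑ²` in the `ofReal (f x ^ 2)` form used throughout the Itô files. [folklore] -/
private theorem enorm_sq_eq_ofReal_sq (f : α → ℝ) (x : α) : ‖f x‖ₑ ^ 2 = ENNReal.ofReal (f x ^ 2) := by
  rw [Real.enorm_eq_ofReal_abs, ← ENNReal.ofReal_pow (abs_nonneg _), sq_abs]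

/-- **Cauchy–Schwarz** in `ℝ≥0∞` form: `∫⁻ ‖a b‖ₑ ≤ (∫⁻ a²)^{1/2} (∫⁻ b²)^{1/2}`.
[cite: Rudin1987, Thm 3.5 (Hölder's inequality, `p = q = 2`)] -/
theorem lintegral_enorm_mul_le_sqrt_mul_sqrt {a b : α → ℝ} (ha : AEStronglyMeasurable a ν)
    (hb : AEStronglyMeasurable b ν) :
    ∫⁻ x, ‖a x * b x‖ₑ ∂ν ≤ (∫⁻ x, ENNReal.ofReal (a x ^ 2) ∂ν) ^ (1 / 2 : ℝ) *
      (∫⁻ x, ENNReal.ofReal (b x ^ 2) ∂ν) ^ (1 / 2 : ℝ) := by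
  have h := ENNReal.lintegral_mul_le_Lp_mul_Lq ν Real.HolderConjugate.two_two
    (f := fun x ↦ ‖a x‖ₑ) (g := fun x ↦ ‖b x‖ₑ) ha.aemeasurable.enorm hb.aemeasurable.enorm
  simp only [Pi.mul_apply, ENNReal.rpow_two, enorm_sq_eq_ofReal_sq] at h
  simpa only [enorm_mul] using h

/-- **Products of `L²`-convergent sequences converge in `L¹`**: if `fₙ → f` and `gₙ → g` in the
squared-`lintegral` sense and `f, g ∈ L²`, then `∫⁻ ‖fₙ gₙ - f g‖ₑ → 0` (continuity of the
product `L² × L² → L¹`, from Hölder's inequality).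
[cite: Rudin1987, Thm 3.5 (Hölder's inequality; continuity of `L² × L² → L¹`)] -/
theorem tendsto_lintegral_enorm_mul_sub_mul {f g : α → ℝ} {fn gn : ℕ → α → ℝ}
    (hf : AEStronglyMeasurable f ν) (hg : AEStronglyMeasurable g ν)
    (hfn : ∀ n, AEStronglyMeasurable (fn n) ν) (hgn : ∀ n, AEStronglyMeasurable (gn n) ν)
    (hf2 : ∫⁻ x, ENNReal.ofReal (f x ^ 2) ∂ν ≠ ∞) (hg2 : ∫⁻ x, ENNReal.ofReal (g x ^ 2) ∂ν ≠ ∞)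
    (hfl : Tendsto (fun n ↦ ∫⁻ x, ENNReal.ofReal ((fn n x - f x) ^ 2) ∂ν) atTop (𝓝 0))
    (hgl : Tendsto (fun n ↦ ∫⁻ x, ENNReal.ofReal ((gn n x - g x) ^ 2) ∂ν) atTop (𝓝 0)) :
    Tendsto (fun n ↦ ∫⁻ x, ‖fn n x * gn n x - f x * g x‖ₑ ∂ν) atTop (𝓝 0) := by
  set A : ℕ → ℝ≥0∞ := fun n ↦ ∫⁻ x, ENNReal.ofReal ((fn n x - f x) ^ 2) ∂ν with hA
  set Bq : ℕ → ℝ≥0∞ := fun n ↦ ∫⁻ x, ENNReal.ofReal ((gn n x - g x) ^ 2) ∂ν with hBq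
  set F : ℝ≥0∞ := ∫⁻ x, ENNReal.ofReal (f x ^ 2) ∂ν with hF
  set G : ℝ≥0∞ := ∫⁻ x, ENNReal.ofReal (g x ^ 2) ∂ν with hG
  -- the square roots tend to `0`
  have hsqrt : ∀ {u : ℕ → ℝ≥0∞}, Tendsto u atTop (𝓝 0) →
      Tendsto (fun n ↦ u n ^ (1 / 2 : ℝ)) atTop (𝓝 0) := by
    intro u hu
    have := (ENNReal.continuous_rpow_const (y := (1 / 2 : ℝ))).tendsto 0
    rw [ENNReal.zero_rpow_of_pos (by norm_num)] at this
    exact this.comp hu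
  have hA0 := hsqrt hfl
  have hB0 := hsqrt hgl
  -- the three-term bound
  have hbound : ∀ n, ∫⁻ x, ‖fn n x * gn n x - f x * g x‖ₑ ∂ν ≤
      A n ^ (1 / 2 : ℝ) * Bq n ^ (1 / 2 : ℝ) + A n ^ (1 / 2 : ℝ) * G ^ (1 / 2 : ℝ) +
        F ^ (1 / 2 : ℝ) * Bq n ^ (1 / 2 : ℝ) := by
    intro n
    have hdf : AEStronglyMeasurable (fun x ↦ fn n x - f x) ν := (hfn n).sub hf
    have hdg : AEStronglyMeasurable (fun x ↦ gn n x - g x) ν := (hgn n).sub hg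
    calc ∫⁻ x, ‖fn n x * gn n x - f x * g x‖ₑ ∂ν
        = ∫⁻ x, ‖(fn n x - f x) * (gn n x - g x) + (fn n x - f x) * g x + f x * (gn n x - g x)‖ₑ ∂ν := by
          congr 1; ext x; congr 1; ring
      _ ≤ ∫⁻ x, ‖(fn n x - f x) * (gn n x - g x)‖ₑ + ‖(fn n x - f x) * g x‖ₑ +
            ‖f x * (gn n x - g x)‖ₑ ∂ν :=
          lintegral_mono fun x ↦ (enorm_add_le _ _).trans (add_le_add (enorm_add_le _ _) le_rfl)
      _ = ∫⁻ x, ‖(fn n x - f x) * (gn n x - g x)‖ₑ ∂ν + ∫⁻ x, ‖(fn n x - f x) * g x‖ₑ ∂ν +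
            ∫⁻ x, ‖f x * (gn n x - g x)‖ₑ ∂ν := by
          have m2 : AEMeasurable (fun x ↦ ‖(fn n x - f x) * g x‖ₑ) ν :=
            (hdf.mul hg).aemeasurable.enorm
          have m3 : AEMeasurable (fun x ↦ ‖f x * (gn n x - g x)‖ₑ) ν :=
            (hf.mul hdg).aemeasurable.enorm
          rw [lintegral_add_right' _ m3, lintegral_add_right' _ m2]
      _ ≤ _ := add_le_add (add_le_add (lintegral_enorm_mul_le_sqrt_mul_sqrt hdf hdg)
            (lintegral_enorm_mul_le_sqrt_mul_sqrt hdf hg)) (lintegral_enorm_mul_le_sqrt_mul_sqrt hf hdg)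
  -- the bound tends to `0`
  have hlim : Tendsto (fun n ↦ A n ^ (1 / 2 : ℝ) * Bq n ^ (1 / 2 : ℝ) +
      A n ^ (1 / 2 : ℝ) * G ^ (1 / 2 : ℝ) + F ^ (1 / 2 : ℝ) * Bq n ^ (1 / 2 : ℝ)) atTop (𝓝 0) := by
    have hG' : G ^ (1 / 2 : ℝ) ≠ ∞ := ENNReal.rpow_ne_top_of_nonneg (by norm_num) hg2
    have hF' : F ^ (1 / 2 : ℝ) ≠ ∞ := ENNReal.rpow_ne_top_of_nonneg (by norm_num) hf2
    have h1 : Tendsto (fun n ↦ A n ^ (1 / 2 : ℝ) * Bq n ^ (1 / 2 : ℝ)) atTop (𝓝 0) := by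
      simpa using ENNReal.Tendsto.mul hA0 (Or.inr ENNReal.zero_ne_top) hB0
        (Or.inr ENNReal.zero_ne_top)
    have h2 : Tendsto (fun n ↦ A n ^ (1 / 2 : ℝ) * G ^ (1 / 2 : ℝ)) atTop (𝓝 0) := by
      simpa using ENNReal.Tendsto.mul_const hA0 (Or.inr hG')
    have h3 : Tendsto (fun n ↦ F ^ (1 / 2 : ℝ) * Bq n ^ (1 / 2 : ℝ)) atTop (𝓝 0) := by
      simpa using ENNReal.Tendsto.const_mul hB0 (Or.inr hF')
    simpa using (h1.add h2).add h3
  exact tendsto_of_tendsto_of_tendsto_of_le_of_le tendsto_const_nhds hlim (fun n ↦ bot_le) hbound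

/-- **Weighted products of `L²`-convergent sequences**: `∫ Z fₙ gₙ → ∫ Z f g` for a bounded
measurable weight `Z`, when `fₙ → f`, `gₙ → g` in `L²` (squared-`lintegral` sense) on a finite
measure space (Hölder's inequality).
[cite: Rudin1987, Thm 3.5 (Hölder's inequality; continuity of `L² × L² → L¹`)] -/
theorem tendsto_integral_mul_mul_of_lintegral_sq [IsFiniteMeasure ν] {f g : α → ℝ}
    {fn gn : ℕ → α → ℝ} {Z : α → ℝ} (hZm : AEStronglyMeasurable Z ν) {C : ℝ} (hC : ∀ x, |Z x| ≤ C)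
    (hf : MemLp f 2 ν) (hg : MemLp g 2 ν) (hfn : ∀ n, MemLp (fn n) 2 ν) (hgn : ∀ n, MemLp (gn n) 2 ν)
    (hfl : Tendsto (fun n ↦ ∫⁻ x, ENNReal.ofReal ((fn n x - f x) ^ 2) ∂ν) atTop (𝓝 0))
    (hgl : Tendsto (fun n ↦ ∫⁻ x, ENNReal.ofReal ((gn n x - g x) ^ 2) ∂ν) atTop (𝓝 0)) :
    Tendsto (fun n ↦ ∫ x, Z x * (fn n x * gn n x) ∂ν) atTop (𝓝 (∫ x, Z x * (f x * g x) ∂ν)) := by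
  have hZb : ∀ᵐ x ∂ν, ‖Z x‖ ≤ C := ae_of_all _ fun x ↦ by simpa [Real.norm_eq_abs] using hC x
  have hsq : ∀ {u : α → ℝ}, MemLp u 2 ν → ∫⁻ x, ENNReal.ofReal (u x ^ 2) ∂ν ≠ ∞ := by
    intro u hu
    have := hu.integrable_sq.2
    rw [hasFiniteIntegral_iff_ofReal (ae_of_all _ fun x ↦ sq_nonneg (u x))] at this
    exact this.ne
  have hI : Integrable (fun x ↦ Z x * (f x * g x)) ν := (hf.integrable_mul hg).bdd_mul hZm hZb
  have hIn : ∀ n, Integrable (fun x ↦ Z x * (fn n x * gn n x)) ν := fun n ↦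
    ((hfn n).integrable_mul (hgn n)).bdd_mul hZm hZb
  refine tendsto_integral_of_L1 (fun x ↦ Z x * (f x * g x)) hI.1 (Eventually.of_forall hIn) ?_
  have hprod := tendsto_lintegral_enorm_mul_sub_mul hf.1 hg.1 (fun n ↦ (hfn n).1) (fun n ↦ (hgn n).1)
    (hsq hf) (hsq hg) hfl hgl
  have hle : ∀ n, ∫⁻ x, ‖Z x * (fn n x * gn n x) - Z x * (f x * g x)‖ₑ ∂ν ≤
      ENNReal.ofReal C * ∫⁻ x, ‖fn n x * gn n x - f x * g x‖ₑ ∂ν := by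
    intro n
    rw [← lintegral_const_mul' _ _ ENNReal.ofReal_ne_top]
    refine lintegral_mono fun x ↦ ?_
    rw [← mul_sub, enorm_mul]
    gcongr
    rw [Real.enorm_eq_ofReal_abs]
    exact ENNReal.ofReal_le_ofReal (hC x)
  have hlim : Tendsto (fun n ↦ ENNReal.ofReal C * ∫⁻ x, ‖fn n x * gn n x - f x * g x‖ₑ ∂ν)
      atTop (𝓝 0) := by
    simpa using ENNReal.Tendsto.const_mul hprod (Or.inr ENNReal.ofReal_ne_top)
  exact tendsto_of_tendsto_of_tendsto_of_le_of_le tendsto_const_nhds hlim (fun n ↦ bot_le) hle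

end L2Tools

end Literature.Probability.Process

end
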